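import Literature.MathematicalPhysics.QuantumFieldTheory.Balaban1983to89.B5Eq118OneStroke
import Literature.MathematicalPhysics.QuantumFieldTheory.Balaban1983to89.B10Eq27TorusAxialLog
import Literature.MathematicalPhysics.QuantumFieldTheory.Balaban1983to89.B4Eq19LatticeOperators
import HarnessLib

/-!
# Line «sandwich_discharge» on crux `HistoryTailL` (stmt-QuantumFields-19936), stub `stub_sandwichSweepGapCapped` (S′), bricks B4 ∕ (B5-d) —
# (Z-e) FILE 6 «THE AVERAGED-PLAQUETTE CHARGE»: the one-stroke sum of ✓(M2) `circ_bondAvgIter_eq_sum` (fine circulations over the `(L^k)^d·(L^k)²`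
# plaquettes of the translated-square family of a level-`k` plaquette) READ IN THE BOX CHART OF THE BLOCK CORNER as the pairing of a COUNTING 2-FORM `ω`
# on `ℤ^d` with the pulled-back plaquette function — `ω`'s support, antisymmetry, total charge `L^{2k}`, height `≤ L^{−k}`, and the pairing identity

Cell `ym3-torus` (YM ladder rung R3 = continuum SU(2) Yang–Mills on the three-torus — a RUNG, NOT the Clay problem: not d = 4, not infinite volume,
not a mass gap); width seat `ym3-torus-px8` gen 7; `--supports stmt-QuantumFields-19936` (helper).  THEOREMS ONLY (0 `def`, default heartbeats); generic
`P : Params` and level `k ≤ m + K`; letters: lit ✓`B5Eq118OneStroke` (`iterBlock`, `mem_iterBlock_iff`), ✓`LatticeFieldCalculus.runSite`, ✓`B10Eq27TorusAxialLog.transl`,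
✓`B4Eq19LatticeOperators` (`Zd`, `box`, `unitVec`).  The counting 2-form is a FREE SYMBOL pinned by a pointwise hypothesis (FILE 1–5 style).

THE OBJECTS.  Level-`k` site `y : Site P k` (= `p.src`), directions `μ ≠ ν`; the CORNER `c : Site P 0` of the block `B^k(y)`, pinned by `hc : (c i).val = (y i).val·L^k`;
the index set `S := (Fin d → Fin L^k) × range L^k × range L^k` of the one-stroke sum and its chart points `pt(r,s,t) := r + s·e_μ + t·e_ν ∈ ℤ^d`;
`N(w) := #{τ ∈ S : pt τ = w}` (the tent ⊗ tent ⊗ flat profile); `ω(w,a,b) := ((L^d)^k)⁻¹·N(w)·([a=μ,b=ν] − [a=ν,b=μ])`.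
* §1 THE CORNER CHART OF A BLOCK (`sitesPerDir 0 = sitesPerDir k·L^k` = lit ✓`B6SectALemma24OneLevelV1.sitesPerDir_zero_eq_mul`, inlined): `val_transl_corner`, `transl_corner_mem_iterBlock`, `exists_eq_transl_corner_of_mem_iterBlock`, ★`sum_iterBlock_eq_sum_transl_corner`
  (`Σ_{x ∈ B^k(y)} g x = Σ_{r : Fin d → Fin L^k} g(transl c r)` — the block IS the chart image of the discrete cube).
* §2 `runSite_transl` (`runSite (transl c w) μ s = transl c (w + s•e_μ)`), ★`sum_oneStroke_eq_sum_transl` (the one-stroke triple sum = `Σ_{τ∈S} g(transl c (pt τ))`).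
* §3 ★`sum_oneStroke_eq_sum_box_count` (fibrewise: `= Σ_{w ∈ box 0 (2L^k)} N(w)·g(transl c w)`; `pt τ ∈ box 0 (2L^k)`).
* §4 THE CHARGE: `charge_anti`, `charge_eq_zero_off_box`, ★`sum_charge_eq` (`Σ_{box 0 ℓ′} ω(·,μ,ν) = L^{2k}` for `2L^k ≤ ℓ′`), `count_le` (`N(w) ≤ (L^k)²`),
  ★`abs_charge_le` (`|ω| ≤ ((L^d)^k)⁻¹·(L^k)²`), ★★`sum_charge_mul_eq_oneStroke` (THE PAIRING: for antisymmetric `Φ`,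
  `Σ_{w ∈ box 0 ℓ′} Σ_{a,b} ω(w,a,b)·Φ(transl c w,a,b) = 2·((L^d)^k)⁻¹·Σ_{x∈B^k(y)}Σ_{s,t<L^k} Φ(runSite (runSite x μ s) ν t, μ, ν)` = twice the one-stroke mean of
  ✓`circ_bondAvgIter_eq_sum`'s right-hand side read through `Φ`).
FILE 7 builds the dipole-MATCHED pair `ω_p − L^{2(j−h)}ω_{P″}` in ONE chart (offset corner) and its masses `M₀ ≤ 4L^{2j}`, `M₁ ≤ 24L^{2j+h}`, `W ≤ 4L^j` for FILE 4∕5.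
HONEST SCOPE: finite combinatorics of the block chart; NOTHING here proves B4, the capped stub, `HistoryTailL`, or any summit statement; YM₃ on T³ is rung R3, not Clay.
[folklore] (the one-stroke form: [Balaban1984PropagatorsI] (1.18) p.20 — lit ✓`B5Eq118OneStroke`, cited there).
-/

noncomputable section

open scoped BigOperators
open Finset

namespace Summit.QuantumFields.YangMills.Theorems.CovariantDischargeAvgPlaqCharge

open Literature.MathematicalPhysics.QuantumFieldTheory.Balaban1983to89
open Literature.MathematicalPhysics.QuantumFieldTheory.Balaban1983to89.B4Eq19LatticeOperators (Zd box mem_box unitVec unitVec_apply_self unitVec_apply_ne)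
open B5Eq118OneStroke (iterBlock mem_iterBlock_iff)
open LatticeFieldCalculus (runSite runSite_zero runSite_succ)
open B10Eq27TorusAxialLog (transl transl_apply transl_add_e)

variable {P : Params} {k : ℕ}

/-! ## §1 The corner chart of a block -/

/-- The label of a corner-chart point: `val((transl c r)_i) = val(y_i)·L^k + r_i` for `r ∈ [0, L^k)^d` (no wrap-around in the standing range). [folklore] -/
theorem val_transl_corner (hk : k ≤ P.m + P.K) (y : Site P k) (c : Site P 0) (hc : ∀ i, (c i).val = (y i).val * P.L ^ k)
    (r : Fin P.d → Fin (P.L ^ k)) (i : Fin P.d) :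
    ((transl c (fun i => ((r i : ℕ) : ℤ))) i).val = (y i).val * P.L ^ k + r i := by
  rw [transl_apply, Int.cast_natCast]
  have hN : P.sitesPerDir 0 = P.sitesPerDir k * P.L ^ k := by  -- (cf. lit `B6SectALemma24OneLevelV1.sitesPerDir_zero_eq_mul`)
    show 2 * P.L ^ (P.m + P.K - 0) = 2 * P.L ^ (P.m + P.K - k) * P.L ^ k
    rw [Nat.sub_zero, mul_assoc, ← pow_add, Nat.sub_add_cancel hk]
  have hlt : (c i).val + (r i : ℕ) < P.sitesPerDir 0 := by
    have hy : (y i).val + 1 ≤ P.sitesPerDir k := ZMod.val_lt (y i)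
    have h1 : ((y i).val + 1) * P.L ^ k ≤ P.sitesPerDir k * P.L ^ k := Nat.mul_le_mul_right _ hy
    rw [hc i]
    have h2 := (r i).isLt
    rw [Nat.add_mul, one_mul] at h1
    omega
  have hrlt : (r i : ℕ) < P.sitesPerDir 0 := by omega
  haveI : NeZero (P.sitesPerDir 0) := ⟨P.sitesPerDir_ne_zero 0⟩
  rw [ZMod.val_add, ZMod.val_natCast, Nat.mod_eq_of_lt hrlt, Nat.mod_eq_of_lt hlt, hc]

/-- Corner-chart points of the discrete cube lie in the block: `transl c r ∈ B^k(y)` for `r ∈ [0, L^k)^d`. [folklore] -/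
theorem transl_corner_mem_iterBlock (hk : k ≤ P.m + P.K) (y : Site P k) (c : Site P 0) (hc : ∀ i, (c i).val = (y i).val * P.L ^ k)
    (r : Fin P.d → Fin (P.L ^ k)) : transl c (fun i => ((r i : ℕ) : ℤ)) ∈ iterBlock k y := by
  rw [mem_iterBlock_iff hk]
  intro i
  rw [val_transl_corner hk y c hc r i]
  have hL : 0 < P.L ^ k := pow_pos P.L_pos k
  rw [Nat.add_comm, Nat.add_mul_div_right _ _ hL, Nat.div_eq_of_lt (r i).isLt, zero_add]

/-- Every site of the block is a corner-chart point of the discrete cube. [folklore] -/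
theorem exists_eq_transl_corner_of_mem_iterBlock (hk : k ≤ P.m + P.K) (y : Site P k) (c : Site P 0) (hc : ∀ i, (c i).val = (y i).val * P.L ^ k)
    {x : Site P 0} (hx : x ∈ iterBlock k y) : ∃ r : Fin P.d → Fin (P.L ^ k), x = transl c (fun i => ((r i : ℕ) : ℤ)) := by
  rw [mem_iterBlock_iff hk] at hx
  have hL : 0 < P.L ^ k := pow_pos P.L_pos k
  have hr : ∀ i, (x i).val - (y i).val * P.L ^ k < P.L ^ k := by
    intro i
    have h1 := Nat.div_add_mod ((x i).val) (P.L ^ k)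
    have h2 := Nat.mod_lt ((x i).val) hL
    rw [hx i, mul_comm] at h1
    omega
  refine ⟨fun i => ⟨(x i).val - (y i).val * P.L ^ k, hr i⟩, ?_⟩
  funext i
  haveI : NeZero (P.sitesPerDir 0) := ⟨P.sitesPerDir_ne_zero 0⟩
  apply ZMod.val_injective
  rw [val_transl_corner hk y c hc _ i]
  simp only
  have h3 : (y i).val * P.L ^ k ≤ (x i).val := by rw [← hx i]; exact Nat.div_mul_le_self _ _
  omega

/-- ★ **THE BLOCK IS THE CHART IMAGE OF THE DISCRETE CUBE**: `Σ_{x ∈ B^k(y)} g x = Σ_{r : Fin d → Fin L^k} g(transl c r)`. [folklore] -/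
theorem sum_iterBlock_eq_sum_transl_corner {M : Type*} [AddCommMonoid M] (hk : k ≤ P.m + P.K) (y : Site P k) (c : Site P 0)
    (hc : ∀ i, (c i).val = (y i).val * P.L ^ k) (g : Site P 0 → M) :
    ∑ x ∈ iterBlock k y, g x = ∑ r : Fin P.d → Fin (P.L ^ k), g (transl c (fun i => ((r i : ℕ) : ℤ))) := by
  classical
  have hinj : Function.Injective (fun r : Fin P.d → Fin (P.L ^ k) => transl c (fun i => ((r i : ℕ) : ℤ))) := by
    intro r r' h
    funext i
    have hv := congrArg (fun z : Site P 0 => (z i).val) h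
    simp only at hv
    rw [val_transl_corner hk y c hc r i, val_transl_corner hk y c hc r' i] at hv
    exact Fin.ext (by omega)
  have himage : iterBlock k y = (Finset.univ : Finset (Fin P.d → Fin (P.L ^ k))).image
      (fun r => transl c (fun i => ((r i : ℕ) : ℤ))) := by
    ext x
    constructor
    · intro hx
      obtain ⟨r, rfl⟩ := exists_eq_transl_corner_of_mem_iterBlock hk y c hc hx
      exact Finset.mem_image.mpr ⟨r, Finset.mem_univ _, rfl⟩
    · intro hx
      obtain ⟨r, -, rfl⟩ := Finset.mem_image.mp hx
      exact transl_corner_mem_iterBlock hk y c hc r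
  rw [himage, Finset.sum_image fun r _ r' _ h => hinj h]

/-! ## §2 Straight runs are chart translations -/

/-- `runSite (transl c w) μ s = transl c (w + s·e_μ)`: a straight run of `s` steps from a chart point is the chart point of the translated label. [folklore] -/
theorem runSite_transl (c : Site P 0) (w : Zd P.d) (μ : Fin P.d) : ∀ s : ℕ, runSite (transl c w) μ s = transl c (w + (s : ℤ) • unitVec μ)
  | 0 => by simp
  | s + 1 => by
    rw [runSite_succ, runSite_transl c w μ s]
    have : w + ((s + 1 : ℕ) : ℤ) • unitVec μ = (w + (s : ℤ) • unitVec μ) + B7Prop1Explicit.e μ := by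
      have he : (B7Prop1Explicit.e μ : Zd P.d) = unitVec μ := rfl
      rw [he]; push_cast; rw [add_smul, one_smul, add_assoc]
    rw [this, transl_add_e]

/-- ★ **THE ONE-STROKE SUM IN THE CHART**: `Σ_{x∈B^k(y)} Σ_{s<L^k} Σ_{t<L^k} g(runSite (runSite x μ s) ν t) = Σ_r Σ_s Σ_t g(transl c (r + s•e_μ + t•e_ν))`. [folklore] -/
theorem sum_oneStroke_eq_sum_transl {M : Type*} [AddCommMonoid M] (hk : k ≤ P.m + P.K) (y : Site P k) (c : Site P 0)
    (hc : ∀ i, (c i).val = (y i).val * P.L ^ k) (μ ν : Fin P.d) (g : Site P 0 → M) :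
    ∑ x ∈ iterBlock k y, ∑ s ∈ Finset.range (P.L ^ k), ∑ t ∈ Finset.range (P.L ^ k), g (runSite (runSite x μ s) ν t)
      = ∑ r : Fin P.d → Fin (P.L ^ k), ∑ s ∈ Finset.range (P.L ^ k), ∑ t ∈ Finset.range (P.L ^ k),
          g (transl c ((fun i => ((r i : ℕ) : ℤ)) + (s : ℤ) • unitVec μ + (t : ℤ) • unitVec ν)) := by
  rw [sum_iterBlock_eq_sum_transl_corner hk y c hc]
  refine Finset.sum_congr rfl fun r _ => Finset.sum_congr rfl fun s _ => Finset.sum_congr rfl fun t _ => ?_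
  rw [runSite_transl, runSite_transl]

/-! ## §3 Fibrewise: the one-stroke sum as a weighted box sum -/

/-- The chart labels of the one-stroke family lie in `box 0 (2L^k)` (indeed in `[0, 2L^k − 2]^d`) when `μ ≠ ν`. [folklore] -/
theorem pt_mem_box (r : Fin P.d → Fin (P.L ^ k)) {s t : ℕ} (hs : s ∈ Finset.range (P.L ^ k)) (ht : t ∈ Finset.range (P.L ^ k)) {μ ν : Fin P.d}
    (hμν : μ ≠ ν) :
    (fun i => ((r i : ℕ) : ℤ)) + (s : ℤ) • unitVec μ + (t : ℤ) • unitVec ν ∈ box (0 : Zd P.d) (2 * (P.L : ℤ) ^ k) := by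
  rw [mem_box]
  intro i
  rw [Finset.mem_range] at hs ht
  have hLk : ((P.L ^ k : ℕ) : ℤ) = (P.L : ℤ) ^ k := by push_cast; ring
  have hr' : ((r i : ℕ) : ℤ) + 1 ≤ (P.L : ℤ) ^ k := by rw [← hLk]; exact_mod_cast (r i).isLt
  have hs' : (s : ℤ) + 1 ≤ (P.L : ℤ) ^ k := by rw [← hLk]; exact_mod_cast hs
  have ht' : (t : ℤ) + 1 ≤ (P.L : ℤ) ^ k := by rw [← hLk]; exact_mod_cast ht
  have hr0 : (0 : ℤ) ≤ ((r i : ℕ) : ℤ) := Int.natCast_nonneg _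
  simp only [Pi.add_apply, Pi.smul_apply, Pi.zero_apply, sub_zero, smul_eq_mul]
  by_cases hμ : i = μ
  · subst hμ
    have hν : i ≠ ν := hμν
    rw [unitVec_apply_self, unitVec_apply_ne hν, mul_one, mul_zero, add_zero, abs_of_nonneg (by positivity)]
    linarith
  · by_cases hν : i = ν
    · subst hν
      rw [unitVec_apply_self, unitVec_apply_ne hμ, mul_one, mul_zero, add_zero, abs_of_nonneg (by positivity)]
      linarith
    · rw [unitVec_apply_ne hμ, unitVec_apply_ne hν, mul_zero, mul_zero, add_zero, add_zero, abs_of_nonneg hr0]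
      have : (0 : ℤ) ≤ (P.L : ℤ) ^ k := by positivity
      linarith

/-- ★ **THE ONE-STROKE SUM AS A WEIGHTED BOX SUM**: with `N(w) := #{(r,s,t) : r + s•e_μ + t•e_ν = w}`,
`Σ_r Σ_s Σ_t g(transl c (r + s•e_μ + t•e_ν)) = Σ_{w ∈ box 0 (2L^k)} N(w)·g(transl c w)`. [folklore] -/
theorem sum_oneStroke_eq_sum_box_count (c : Site P 0) {μ ν : Fin P.d} (hμν : μ ≠ ν) (g : Site P 0 → ℝ) :
    ∑ r : Fin P.d → Fin (P.L ^ k), ∑ s ∈ Finset.range (P.L ^ k), ∑ t ∈ Finset.range (P.L ^ k),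
        g (transl c ((fun i => ((r i : ℕ) : ℤ)) + (s : ℤ) • unitVec μ + (t : ℤ) • unitVec ν))
      = ∑ w ∈ box (0 : Zd P.d) (2 * (P.L : ℤ) ^ k),
          ((((Finset.univ : Finset (Fin P.d → Fin (P.L ^ k))) ×ˢ (Finset.range (P.L ^ k) ×ˢ Finset.range (P.L ^ k))).filter
              (fun τ => (fun i => ((τ.1 i : ℕ) : ℤ)) + (τ.2.1 : ℤ) • unitVec μ + (τ.2.2 : ℤ) • unitVec ν = w)).card : ℝ) * g (transl c w) := by
  classical
  -- the triple sum as a sum over the product index set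
  have htriple : ∑ r : Fin P.d → Fin (P.L ^ k), ∑ s ∈ Finset.range (P.L ^ k), ∑ t ∈ Finset.range (P.L ^ k),
        g (transl c ((fun i => ((r i : ℕ) : ℤ)) + (s : ℤ) • unitVec μ + (t : ℤ) • unitVec ν))
      = ∑ τ ∈ (Finset.univ : Finset (Fin P.d → Fin (P.L ^ k))) ×ˢ (Finset.range (P.L ^ k) ×ˢ Finset.range (P.L ^ k)),
          g (transl c ((fun i => ((τ.1 i : ℕ) : ℤ)) + (τ.2.1 : ℤ) • unitVec μ + (τ.2.2 : ℤ) • unitVec ν)) := by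
    rw [Finset.sum_product]
    refine Finset.sum_congr rfl fun r _ => ?_
    rw [Finset.sum_product]
  rw [htriple]
  -- fibrewise over the box
  have hmaps : ∀ τ ∈ (Finset.univ : Finset (Fin P.d → Fin (P.L ^ k))) ×ˢ (Finset.range (P.L ^ k) ×ˢ Finset.range (P.L ^ k)),
      (fun i => ((τ.1 i : ℕ) : ℤ)) + (τ.2.1 : ℤ) • unitVec μ + (τ.2.2 : ℤ) • unitVec ν ∈ box (0 : Zd P.d) (2 * (P.L : ℤ) ^ k) := by
    intro τ hτ
    rw [Finset.mem_product, Finset.mem_product] at hτ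
    exact pt_mem_box τ.1 hτ.2.1 hτ.2.2 hμν
  rw [← Finset.sum_fiberwise_of_maps_to hmaps]
  refine Finset.sum_congr rfl fun w _ => ?_
  rw [Finset.sum_filter]
  rw [Finset.card_filter, Nat.cast_sum, Finset.sum_mul]
  refine Finset.sum_congr rfl fun τ _ => ?_
  by_cases h : (fun i => ((τ.1 i : ℕ) : ℤ)) + (τ.2.1 : ℤ) • unitVec μ + (τ.2.2 : ℤ) • unitVec ν = w
  · rw [if_pos h, if_pos h, h]; simp
  · rw [if_neg h, if_neg h]; simp


/-! ## §4 The counting charge `ω` -/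

section Charge

variable (μ ν : Fin P.d)

/-- The charge is antisymmetric in its form indices. [folklore] -/
theorem charge_anti (κ : ℝ) (N : Zd P.d → ℝ) (ω : Zd P.d → Fin P.d → Fin P.d → ℝ)
    (hω : ∀ w a b, ω w a b = κ * N w * ((if a = μ ∧ b = ν then 1 else 0) - (if a = ν ∧ b = μ then 1 else 0))) (w : Zd P.d) (a b : Fin P.d) :
    ω w b a = -ω w a b := by
  rw [hω, hω]
  by_cases h1 : a = μ <;> by_cases h2 : b = ν <;> by_cases h3 : a = ν <;> by_cases h4 : b = μ <;> simp [h1, h2, h3, h4] <;> ring_nf <;> simp_all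

/-- The double index sum of the charge against any `X`: `Σ_a Σ_b ω(w,a,b)·X a b = κ·N(w)·(X μ ν − X ν μ)`. [folklore] -/
theorem sum_sum_charge_mul (κ : ℝ) (N : Zd P.d → ℝ) (ω : Zd P.d → Fin P.d → Fin P.d → ℝ)
    (hω : ∀ w a b, ω w a b = κ * N w * ((if a = μ ∧ b = ν then 1 else 0) - (if a = ν ∧ b = μ then 1 else 0))) (w : Zd P.d) (X : Fin P.d → Fin P.d → ℝ) :
    ∑ a, ∑ b, ω w a b * X a b = κ * N w * (X μ ν - X ν μ) := by
  simp only [hω, mul_sub, sub_mul, Finset.sum_sub_distrib, mul_assoc, ← Finset.mul_sum]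
  congr 1
  · congr 1
    rw [Finset.sum_eq_single μ (fun a _ ha => by simp [ha]) (fun h => (h (Finset.mem_univ _)).elim)]
    rw [Finset.sum_eq_single ν (fun b _ hb => by simp [hb]) (fun h => (h (Finset.mem_univ _)).elim)]
    simp
  · congr 1
    rw [Finset.sum_eq_single ν (fun a _ ha => by simp [ha]) (fun h => (h (Finset.mem_univ _)).elim)]
    rw [Finset.sum_eq_single μ (fun b _ hb => by simp [hb]) (fun h => (h (Finset.mem_univ _)).elim)]
    simp

variable {μ ν}

/-- The fibre count vanishes off `box 0 (2L^k)` (`μ ≠ ν`). [folklore] -/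
theorem count_eq_zero_off_box (hμν : μ ≠ ν) {w : Zd P.d} (hw : w ∉ box (0 : Zd P.d) (2 * (P.L : ℤ) ^ k)) :
    (((Finset.univ : Finset (Fin P.d → Fin (P.L ^ k))) ×ˢ (Finset.range (P.L ^ k) ×ˢ Finset.range (P.L ^ k))).filter
        (fun τ => (fun i => ((τ.1 i : ℕ) : ℤ)) + (τ.2.1 : ℤ) • unitVec μ + (τ.2.2 : ℤ) • unitVec ν = w)).card = 0 := by
  rw [Finset.card_eq_zero, Finset.filter_eq_empty_iff]
  intro τ hτ h
  rw [Finset.mem_product, Finset.mem_product] at hτ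
  exact hw (h ▸ pt_mem_box τ.1 hτ.2.1 hτ.2.2 hμν)

/-- ★ **TOTAL COUNT**: `Σ_{w ∈ box 0 ℓ′} N(w) = #S = (L^k)^d·(L^k)²` whenever `2L^k ≤ ℓ′`. [folklore] -/
theorem sum_count_eq (hμν : μ ≠ ν) {ℓ' : ℤ} (hℓ' : 2 * (P.L : ℤ) ^ k ≤ ℓ') :
    ∑ w ∈ box (0 : Zd P.d) ℓ',
      ((((Finset.univ : Finset (Fin P.d → Fin (P.L ^ k))) ×ˢ (Finset.range (P.L ^ k) ×ˢ Finset.range (P.L ^ k))).filter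
          (fun τ => (fun i => ((τ.1 i : ℕ) : ℤ)) + (τ.2.1 : ℤ) • unitVec μ + (τ.2.2 : ℤ) • unitVec ν = w)).card : ℝ)
      = ((P.L : ℝ) ^ k) ^ P.d * ((P.L : ℝ) ^ k * (P.L : ℝ) ^ k) := by
  classical
  have hmaps : ∀ τ ∈ (Finset.univ : Finset (Fin P.d → Fin (P.L ^ k))) ×ˢ (Finset.range (P.L ^ k) ×ˢ Finset.range (P.L ^ k)),
      (fun i => ((τ.1 i : ℕ) : ℤ)) + (τ.2.1 : ℤ) • unitVec μ + (τ.2.2 : ℤ) • unitVec ν ∈ box (0 : Zd P.d) ℓ' := by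
    intro τ hτ
    rw [Finset.mem_product, Finset.mem_product] at hτ
    exact B4Eq19LatticeOperators.box_mono 0 hℓ' (pt_mem_box τ.1 hτ.2.1 hτ.2.2 hμν)
  have h := Finset.card_eq_sum_card_fiberwise hmaps
  have hcast : (((Finset.univ : Finset (Fin P.d → Fin (P.L ^ k))) ×ˢ (Finset.range (P.L ^ k) ×ˢ Finset.range (P.L ^ k))).card : ℝ)
      = ((P.L : ℝ) ^ k) ^ P.d * ((P.L : ℝ) ^ k * (P.L : ℝ) ^ k) := by
    rw [Finset.card_product, Finset.card_product, Finset.card_univ, Fintype.card_pi, Finset.card_range]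
    simp only [Fintype.card_fin, Finset.prod_const, Finset.card_univ]
    push_cast; ring
  rw [← hcast, h]
  push_cast
  rfl

/-- **THE FIBRE COUNT IS AT MOST `(L^k)²`**: on a fibre the offset `r` is determined by `(s,t)`. [folklore] -/
theorem count_le (w : Zd P.d) :
    (((Finset.univ : Finset (Fin P.d → Fin (P.L ^ k))) ×ˢ (Finset.range (P.L ^ k) ×ˢ Finset.range (P.L ^ k))).filter
        (fun τ => (fun i => ((τ.1 i : ℕ) : ℤ)) + (τ.2.1 : ℤ) • unitVec μ + (τ.2.2 : ℤ) • unitVec ν = w)).card ≤ P.L ^ k * P.L ^ k := by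
  classical
  have h := Finset.card_le_card_of_injOn (fun τ : (Fin P.d → Fin (P.L ^ k)) × (ℕ × ℕ) => τ.2)
    (s := (((Finset.univ : Finset (Fin P.d → Fin (P.L ^ k))) ×ˢ (Finset.range (P.L ^ k) ×ˢ Finset.range (P.L ^ k))).filter
        (fun τ => (fun i => ((τ.1 i : ℕ) : ℤ)) + (τ.2.1 : ℤ) • unitVec μ + (τ.2.2 : ℤ) • unitVec ν = w)))
    (t := Finset.range (P.L ^ k) ×ˢ Finset.range (P.L ^ k)) ?_ ?_
  · rwa [Finset.card_product, Finset.card_range] at h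
  · intro τ hτ
    rw [Finset.mem_coe, Finset.mem_filter, Finset.mem_product] at hτ
    exact hτ.1.2
  · intro τ hτ τ' hτ' h2
    rw [Finset.mem_coe, Finset.mem_filter] at hτ hτ'
    have h1 : (fun i => ((τ.1 i : ℕ) : ℤ)) = fun i => ((τ'.1 i : ℕ) : ℤ) := by
      have e := hτ.2.trans hτ'.2.symm
      simp only at h2
      rw [h2] at e
      exact add_right_cancel (add_right_cancel e)
    refine Prod.ext ?_ h2
    funext i
    have := congrFun h1 i
    exact Fin.ext (by exact_mod_cast this)

/-- ★ **THE CHARGE IS AT MOST `((L^d)^k)⁻¹·(L^k)²` IN ABSOLUTE VALUE** (`= L^{−k}` in `d = 3`). [folklore] -/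
theorem abs_charge_le (ω : Zd P.d → Fin P.d → Fin P.d → ℝ)
    (hω : ∀ w a b, ω w a b = ((((P.L : ℝ) ^ P.d) ^ k)⁻¹ *
      ((((Finset.univ : Finset (Fin P.d → Fin (P.L ^ k))) ×ˢ (Finset.range (P.L ^ k) ×ˢ Finset.range (P.L ^ k))).filter
        (fun τ => (fun i => ((τ.1 i : ℕ) : ℤ)) + (τ.2.1 : ℤ) • unitVec μ + (τ.2.2 : ℤ) • unitVec ν = w)).card : ℝ)) *
      ((if a = μ ∧ b = ν then 1 else 0) - (if a = ν ∧ b = μ then 1 else 0))) (w : Zd P.d) (a b : Fin P.d) :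
    |ω w a b| ≤ (((P.L : ℝ) ^ P.d) ^ k)⁻¹ * ((P.L : ℝ) ^ k * (P.L : ℝ) ^ k) := by
  rw [hω, abs_mul, abs_mul]
  have hκ : (0 : ℝ) ≤ (((P.L : ℝ) ^ P.d) ^ k)⁻¹ := by positivity
  have hN : |((((Finset.univ : Finset (Fin P.d → Fin (P.L ^ k))) ×ˢ (Finset.range (P.L ^ k) ×ˢ Finset.range (P.L ^ k))).filter
        (fun τ => (fun i => ((τ.1 i : ℕ) : ℤ)) + (τ.2.1 : ℤ) • unitVec μ + (τ.2.2 : ℤ) • unitVec ν = w)).card : ℝ)|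
      ≤ (P.L : ℝ) ^ k * (P.L : ℝ) ^ k := by
    rw [abs_of_nonneg (Nat.cast_nonneg _)]
    exact_mod_cast count_le (μ := μ) (ν := ν) w
  have hI : |((if a = μ ∧ b = ν then (1 : ℝ) else 0) - (if a = ν ∧ b = μ then 1 else 0))| ≤ 1 := by
    split_ifs <;> norm_num
  rw [abs_of_nonneg hκ]
  calc (((P.L : ℝ) ^ P.d) ^ k)⁻¹ * |(((((Finset.univ : Finset (Fin P.d → Fin (P.L ^ k))) ×ˢ (Finset.range (P.L ^ k) ×ˢ Finset.range (P.L ^ k))).filter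
          (fun τ => (fun i => ((τ.1 i : ℕ) : ℤ)) + (τ.2.1 : ℤ) • unitVec μ + (τ.2.2 : ℤ) • unitVec ν = w)).card : ℝ))|
        * |((if a = μ ∧ b = ν then (1 : ℝ) else 0) - (if a = ν ∧ b = μ then 1 else 0))|
      ≤ (((P.L : ℝ) ^ P.d) ^ k)⁻¹ * ((P.L : ℝ) ^ k * (P.L : ℝ) ^ k) * 1 := by
        exact mul_le_mul (mul_le_mul_of_nonneg_left hN hκ) hI (abs_nonneg _) (by positivity)
    _ = _ := mul_one _

/-- ★★ **THE PAIRING IDENTITY** (B5-d at one height): for every antisymmetric reading `Φ` of the fine torus plaquettes and `2L^k ≤ ℓ′`,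
`Σ_{w ∈ box 0 ℓ′} Σ_a Σ_b ω(w,a,b)·Φ(transl c w,a,b) = 2·((L^d)^k)⁻¹·Σ_{x∈B^k(y)} Σ_{s<L^k} Σ_{t<L^k} Φ(runSite (runSite x μ s) ν t, μ, ν)` — the right-hand side is
`2/L^k` times the one-stroke form of ✓(M2) `circ_bondAvgIter_eq_sum` read through `Φ`. [folklore] -/
theorem sum_charge_mul_eq_oneStroke (hk : k ≤ P.m + P.K) (y : Site P k) (c : Site P 0) (hc : ∀ i, (c i).val = (y i).val * P.L ^ k) (hμν : μ ≠ ν)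
    (ω : Zd P.d → Fin P.d → Fin P.d → ℝ)
    (hω : ∀ w a b, ω w a b = ((((P.L : ℝ) ^ P.d) ^ k)⁻¹ *
      ((((Finset.univ : Finset (Fin P.d → Fin (P.L ^ k))) ×ˢ (Finset.range (P.L ^ k) ×ˢ Finset.range (P.L ^ k))).filter
        (fun τ => (fun i => ((τ.1 i : ℕ) : ℤ)) + (τ.2.1 : ℤ) • unitVec μ + (τ.2.2 : ℤ) • unitVec ν = w)).card : ℝ)) *
      ((if a = μ ∧ b = ν then 1 else 0) - (if a = ν ∧ b = μ then 1 else 0)))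
    (Φ : Site P 0 → Fin P.d → Fin P.d → ℝ) (hΦ : ∀ x a b, Φ x b a = -Φ x a b) {ℓ' : ℤ} (hℓ' : 2 * (P.L : ℤ) ^ k ≤ ℓ') :
    ∑ w ∈ box (0 : Zd P.d) ℓ', ∑ a, ∑ b, ω w a b * Φ (transl c w) a b
      = 2 * (((P.L : ℝ) ^ P.d) ^ k)⁻¹ *
          ∑ x ∈ iterBlock k y, ∑ s ∈ Finset.range (P.L ^ k), ∑ t ∈ Finset.range (P.L ^ k), Φ (runSite (runSite x μ s) ν t) μ ν := by
  classical
  -- the index sums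
  have hinner : ∀ w, ∑ a, ∑ b, ω w a b * Φ (transl c w) a b
      = 2 * (((P.L : ℝ) ^ P.d) ^ k)⁻¹ *
        (((((Finset.univ : Finset (Fin P.d → Fin (P.L ^ k))) ×ˢ (Finset.range (P.L ^ k) ×ˢ Finset.range (P.L ^ k))).filter
            (fun τ => (fun i => ((τ.1 i : ℕ) : ℤ)) + (τ.2.1 : ℤ) • unitVec μ + (τ.2.2 : ℤ) • unitVec ν = w)).card : ℝ)
          * Φ (transl c w) μ ν) := by
    intro w
    rw [sum_sum_charge_mul μ ν _ _ ω hω w (fun a b => Φ (transl c w) a b), hΦ]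
    ring
  simp only [hinner, ← Finset.mul_sum]
  congr 1
  -- restrict to `box 0 (2L^k)` (the count vanishes outside), then un-fibre
  have hsub : box (0 : Zd P.d) (2 * (P.L : ℤ) ^ k) ⊆ box (0 : Zd P.d) ℓ' := B4Eq19LatticeOperators.box_mono 0 hℓ'
  rw [← Finset.sum_subset hsub (fun w _ hw => by rw [count_eq_zero_off_box hμν hw]; simp)]
  rw [← sum_oneStroke_eq_sum_box_count c hμν (fun x => Φ x μ ν), sum_oneStroke_eq_sum_transl hk y c hc μ ν (fun x => Φ x μ ν)]

end Charge

end Summit.QuantumFields.YangMills.Theorems.CovariantDischargeAvgPlaqCharge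

end
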